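import Summits.NavierStokesRegularity.NavierStokesRegularity.Theorems.StrainDoorsPeakDoors
import HarnessLib

/-!
# Strain doors, PART L — the near-record stretching law on the original solution (ROUND 60 of the

(Tree file 1 of 2 of PART L — §L1–§L2 (stretching = geometry on the peak class, cap ⟺ geometric ceiling, near-record extraction); §L3 (the laws on the original solution) are in `StrainDoorsNearRecordLaw`, which imports this file.
Text of nsreg-p1 g35 r60/StrainDoorsNearRecordLaw.lean sha256 8b224fcf95c71fb9, split at the 400-line cap at a § boundary,
bodies verbatim.)
ns-regularity-ideate cell)

PARTS H–K moved the record law to the TANGENT field of a Type-I solution.  This file pulls it back to the ORIGINAL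
solution, uniformly over the Type-I class with one constant `C₀`, with NO limit object in the statements:

* §L1 on the Type-I tangent peak class the stretching rate at the peak is a function of the GEOMETRY of the
  vorticity there (record identity, PART J): the dynamic door «PeakStretchingCap κ» of PART K is EQUIVALENT to the
  geometric ceiling «twist + scale-free concavity `< κ`» (`peakStretchingCap_iff_geometric_ceiling`);
* §L2 the NEAR-RECORD EXTRACTION lemma: from points of Type-I solutions whose scale-invariant vorticity comes within
  `δ_j → 0` of an upper bound `W_j ≥ w₀ > 0` of the vorticity number one extracts a member of the peak class with
  `ρ̄ ≥ w₀` along which the scale-invariant STRETCHING RATES converge (`typeI_nearRecord_extraction`; PARTS G, H);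
* §L3 laws ON `u` ITSELF: the near-record stretching FLOOR `(0 − t)⟪ξ,∇u ξ⟫ ≥ 1 − ε` (`typeI_nearRecord_stretching`),
  the near-record stretching PINCH `≤ 1 + K₃(C₀)/w₀ + ε` (`typeI_nearRecord_stretching_pinch`), near-critical
  stretching points exist in every non-trivial Type-I ancient solution (`typeI_exists_nearCritical_stretching`), and
  the Liouville theorem under a uniform stretching cap (`eq_zero_of_typeI_of_stretching_le`), which needs the cap
  on the NEAR-RECORD set only (`eq_zero_of_typeI_of_nearRecord_stretching_cap`).

References: Koch–Nadirashvili–Seregin–Šverák, Acta Math. 203 (2009), Lemma 3.1, §4 (4.11) [KNSS2009];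
Constantin–Fefferman, Indiana Univ. Math. J. 42 (1993); Beale–Kato–Majda, Comm. Math. Phys. 94 (1984).
-/

noncomputable section

open MeasureTheory Set Function Filter Metric Real InnerProductSpace
open _root_.Topology
open scoped ENNReal NNReal RealInnerProductSpace ContDiff Laplacian
open Literature.Analysis Literature.Analysis.FluidPDE
open Literature.Analysis.FluidPDE.VorticityDirectionDynamics

set_option linter.unusedVariables false
set_option linter.unusedSectionVars false

namespace Summit.NavierStokesRegularity.NavierStokesRegularity.Theorems.StrainDoors

open Summit.NavierStokesRegularity.NavierStokesRegularity.Theorems.ArgmaxDoors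

/-! # PART L — THE NEAR-RECORD STRETCHING LAW ON `u` ITSELF (ROUND 60)

§L1: by the record identity (PART J) the stretching rate at a Type-I tangent peak is a FUNCTION of the geometry of
the vorticity there, `(0 − (−1))ᾱ = 1 + (0 − (−1))(|∇ξ̄|²_F + (−Δ|ω|)(z̄)/ρ̄)`; so the dynamic door
«PeakStretchingCap κ» (PART K) is EQUIVALENT to the geometric ceiling «twist + concavity `< κ`».
§L2: an EXTRACTION LEMMA: from any sequence of space-time points of classical Type-I solutions (one constant `C₀`)
whose scale-invariant vorticity comes within `δ_j → 0` of an upper bound `W_j ≥ w₀ > 0` of the vorticity number, one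
extracts a member `(v, z̄)` of the Type-I tangent peak class with `ρ̄ ≥ w₀` along which the scale-invariant
STRETCHING RATES `(0 − t_j)α_j` at the points converge to `(0 − (−1))ᾱ` at the peak.
§L3: ★★★ consequences ON THE ORIGINAL SOLUTION, uniform in the class and with no limit object in the statements:
the near-record stretching FLOOR `(0 − t)α ≥ 1 − ε`, the near-record stretching PINCH `(0 − t)α ≤ 1 + K₃(C₀)/w₀ + ε`,
the existence of near-critical stretching points in every non-trivial Type-I ancient solution, and the Liouville
theorem under a uniform stretching cap (needed on the near-record set only). -/

/-! ## §L1 The stretching rate at the peak is geometry -/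

/-- **On the peak class the stretching rate is geometry:** `(0 − (−1))ᾱ = 1 + (0 − (−1))(F + (−L)/ρ̄)` with
`F = |∇ξ̄|²_F`, `L = Δ|ω_v(−1,·)|(z̄) ≤ 0`, `ρ̄ = |ω_v(−1,z̄)|` (record identity of PART J, rearranged). -/
theorem IsTypeITangentPeak.stretching_eq_geometry {C₀ : ℝ}
    {v : ℝ → (EuclideanSpace ℝ (Fin 3)) → (EuclideanSpace ℝ (Fin 3))} {zbar : EuclideanSpace ℝ (Fin 3)}
    (h : IsTypeITangentPeak C₀ v zbar) :
    (0 - (-1)) * ⟪vorticityDirection (curl (v (-1))) zbar,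
        fderiv ℝ (v (-1)) zbar (vorticityDirection (curl (v (-1))) zbar)⟫ =
      1 + (0 - (-1)) * (frobeniusNormSq (fderiv ℝ (vorticityDirection (curl (v (-1)))) zbar) +
        (-(Δ fun y => ‖curl (v (-1)) y‖) zbar) / ‖curl (v (-1)) zbar‖) := by
  obtain ⟨-, -, -, hid, -, -⟩ := h.record_identity
  have e : (0 - (-1)) * (-(Δ fun y => ‖curl (v (-1)) y‖) zbar) / ‖curl (v (-1)) zbar‖ =
      (0 - (-1)) * ((-(Δ fun y => ‖curl (v (-1)) y‖) zbar) / ‖curl (v (-1)) zbar‖) := by ring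
  linarith [hid, e]

/-- ★★ **THE DYNAMIC DOOR IS A GEOMETRIC DOOR.**  On the Type-I tangent peak class, «PeakStretchingCap κ» (a strict
cap `(0 − (−1))ᾱ < 1 + (0 − (−1))κ` on the stretching rate at the peak) is EQUIVALENT to the strict ceiling
`|∇ξ̄|²_F + (−Δ|ω_v(−1)|)(z̄)/ρ̄ < κ` on twist plus scale-free concavity of the vorticity at the peak. -/
theorem peakStretchingCap_iff_geometric_ceiling (C₀ κ : ℝ) :
    PeakStretchingCap C₀ κ ↔
      ∀ (v : ℝ → (EuclideanSpace ℝ (Fin 3)) → (EuclideanSpace ℝ (Fin 3))) (zbar : EuclideanSpace ℝ (Fin 3)),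
        IsTypeITangentPeak C₀ v zbar →
          frobeniusNormSq (fderiv ℝ (vorticityDirection (curl (v (-1)))) zbar) +
            (-(Δ fun y => ‖curl (v (-1)) y‖) zbar) / ‖curl (v (-1)) zbar‖ < κ := by
  constructor
  · intro hcap v zbar h
    have e := h.stretching_eq_geometry
    have hc := hcap v zbar h
    nlinarith [e, hc]
  · intro hceil v zbar h
    have e := h.stretching_eq_geometry
    have hc := hceil v zbar h
    show (0 - (-1)) * _ < 1 + (0 - (-1)) * κ
    nlinarith [e, hc]

/-- Hence a concavity FLOOR `κ ≤ (−Δ|ω|)(z̄)/ρ̄` together with the geometric CEILING `F + (−Δ|ω|)(z̄)/ρ̄ < κ` is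
contradictory on every member (`F ≥ 0`): the class is empty. -/
theorem peakClassEmpty_of_concavityFloor_of_geometric_ceiling {C₀ κ : ℝ} (hfl : PeakConcavityFloor C₀ κ)
    (hceil : ∀ (v : ℝ → (EuclideanSpace ℝ (Fin 3)) → (EuclideanSpace ℝ (Fin 3))) (zbar : EuclideanSpace ℝ (Fin 3)),
        IsTypeITangentPeak C₀ v zbar →
          frobeniusNormSq (fderiv ℝ (vorticityDirection (curl (v (-1)))) zbar) +
            (-(Δ fun y => ‖curl (v (-1)) y‖) zbar) / ‖curl (v (-1)) zbar‖ < κ) :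
    PeakClassEmpty C₀ :=
  peakClassEmpty_of_concavityFloor_of_cap hfl ((peakStretchingCap_iff_geometric_ceiling C₀ κ).2 hceil)

/-! ## §L2 The near-record extraction lemma -/

/-- ★★ **NEAR-RECORD EXTRACTION.**  Let `(u_j, p_j)` be classical solutions of Navier–Stokes (`ν = 1`, `f = 0`) on
`(−∞,0) × ℝ³`, all Type-I with the same constant `C₀`; let `W_j ≥ w₀ > 0` bound the vorticity number of `u_j`
(`(0 − s)|ω_j(s,y)| ≤ W_j`), and let `(t_j, x_j)`, `t_j < 0`, be points with `(0 − t_j)|ω_j(t_j,x_j)| ≥ W_j − δ_j`,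
`0 ≤ δ_j ≤ w₀/2`, `δ_j → 0`.  Then there are a member `(v, z̄)` of the Type-I tangent peak class (PART K) with peak
height `ρ̄ = |ω_v(−1,z̄)| ≥ w₀` and a subsequence `θ` along which the scale-invariant stretching rates converge:
`(0 − t_{θj})·⟪ξ_j, ∇u_j ξ_j⟫(t_{θj}, x_{θj}) → (0 − (−1))·⟪ξ̄, ∇v(−1,z̄) ξ̄⟫`.  (Rescale each point to time `−1`;
the rescaled points stay in a parabolic cone (PART G); tangent field with gradients (PART H); Bolzano–Weierstrass on
(centre, number); vorticities and gradients converge along MOVING points by the uniform spatial Lipschitz bounds.)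
[new-as-typed] -/
theorem typeI_nearRecord_extraction {C₀ w₀ : ℝ} (hw₀ : 0 < w₀)
    {u : ℕ → ℝ → (EuclideanSpace ℝ (Fin 3)) → (EuclideanSpace ℝ (Fin 3))}
    {p : ℕ → ℝ → (EuclideanSpace ℝ (Fin 3)) → ℝ} {W t δ : ℕ → ℝ} {x : ℕ → EuclideanSpace ℝ (Fin 3)}
    (hsol : ∀ j, IsClassicalNSSolutionOn (Iio 0) 1 0 (u j) (p j)) (hI : ∀ j, HasTypeIDecay C₀ (u j))
    (hdom : ∀ j, ∀ s : ℝ, s < 0 → ∀ y, (0 - s) * ‖curl (u j s) y‖ ≤ W j) (hW : ∀ j, w₀ ≤ W j)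
    (ht : ∀ j, t j < 0) (hnear : ∀ j, W j - δ j ≤ (0 - t j) * ‖curl (u j (t j)) (x j)‖)
    (hδ1 : ∀ j, δ j ≤ w₀ / 2) (hδ : Tendsto δ atTop (𝓝 0)) :
    ∃ (v : ℝ → (EuclideanSpace ℝ (Fin 3)) → (EuclideanSpace ℝ (Fin 3))) (zbar : EuclideanSpace ℝ (Fin 3)),
      IsTypeITangentPeak C₀ v zbar ∧ w₀ ≤ ‖curl (v (-1)) zbar‖ ∧
      ∃ θ : ℕ → ℕ, StrictMono θ ∧
        Tendsto (fun j => (0 - t (θ j)) * ⟪vorticityDirection (curl (u (θ j) (t (θ j)))) (x (θ j)),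
            fderiv ℝ (u (θ j) (t (θ j))) (x (θ j)) (vorticityDirection (curl (u (θ j) (t (θ j)))) (x (θ j)))⟫)
          atTop (𝓝 ((0 - (-1)) * ⟪vorticityDirection (curl (v (-1))) zbar,
            fderiv ℝ (v (-1)) zbar (vorticityDirection (curl (v (-1))) zbar)⟫)) := by
  have hC₀ : 0 ≤ C₀ := HasTypeIDecay.nonneg' (hI 0)
  -- rescale every point to time `-1`
  obtain ⟨lam, hlam⟩ : ∃ lam : ℕ → ℝ, lam = fun j => √(0 - t j) := ⟨_, rfl⟩
  have hlam0 : ∀ j, 0 < lam j := fun j => by rw [hlam]; exact Real.sqrt_pos.mpr (by linarith [ht j])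
  have hlam2 : ∀ j, lam j ^ 2 = 0 - t j := fun j => by rw [hlam]; exact Real.sq_sqrt (by linarith [ht j])
  obtain ⟨u', hu'⟩ : ∃ u' : ℕ → ℝ → (EuclideanSpace ℝ (Fin 3)) → (EuclideanSpace ℝ (Fin 3)),
      u' = fun j => nsRescale (lam j) (u j) := ⟨_, rfl⟩
  obtain ⟨z, hz⟩ : ∃ z : ℕ → EuclideanSpace ℝ (Fin 3), z = fun j => (lam j)⁻¹ • x j := ⟨_, rfl⟩
  have hcl : ∀ j, IsClassicalNSSolutionOn (Iio 0) 1 0 (u' j) (nsRescalePressure (lam j) (p j)) := fun j => by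
    rw [hu']; exact (typeI_class_nsRescale (hlam0 j) (hsol j) (hI j)).1
  have hIj : ∀ j, HasTypeIDecay C₀ (u' j) := fun j => by
    rw [hu']; exact (typeI_class_nsRescale (hlam0 j) (hsol j) (hI j)).2
  have hxz : ∀ j, lam j • z j = x j := fun j => by rw [hz]; exact smul_inv_smul₀ (hlam0 j).ne' _
  have ht1 : ∀ j, lam j ^ 2 * (-1) = t j := fun j => by rw [hlam2]; ring
  have hnum : ∀ j, ∀ s : ℝ, s < 0 → ∀ y, (0 - s) * ‖curl (u' j s) y‖ ≤ W j := fun j s hs y => by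
    rw [hu']; dsimp only
    rw [vorticityNumber_nsRescale]
    have hs' : lam j ^ 2 * s < 0 := mul_neg_of_pos_of_neg (pow_pos (hlam0 j) 2) hs
    exact hdom j _ hs' _
  have hcurl' : ∀ j, curl (u' j (-1)) (z j) = (0 - t j) • curl (u j (t j)) (x j) := fun j => by
    rw [hu']; dsimp only
    rw [curl_eq_curlCLM, curl_eq_curlCLM, fderiv_nsRescale, map_smul, ht1, hxz, hlam2]
  have hfd' : ∀ j, fderiv ℝ (u' j (-1)) (z j) = (0 - t j) • fderiv ℝ (u j (t j)) (x j) := fun j => by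
    rw [hu']; dsimp only
    rw [fderiv_nsRescale, ht1, hxz, hlam2]
  have hnorm' : ∀ j, ‖curl (u' j (-1)) (z j)‖ = (0 - t j) * ‖curl (u j (t j)) (x j)‖ := fun j => by
    rw [hcurl', norm_smul, Real.norm_of_nonneg (by linarith [ht j])]
  have hnear' : ∀ j, W j - δ j ≤ ‖curl (u' j (-1)) (z j)‖ := fun j => by rw [hnorm']; exact hnear j
  have hξ' : ∀ j, vorticityDirection (curl (u' j (-1))) (z j) = vorticityDirection (curl (u j (t j))) (x j) := by
    intro j
    have h0 : (0 - t j) ≠ 0 := by linarith [ht j]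
    rw [vorticityDirection_apply, vorticityDirection_apply, hcurl', norm_smul,
      Real.norm_of_nonneg (by linarith [ht j]), mul_inv, smul_smul, mul_right_comm, inv_mul_cancel₀ h0,
      one_mul]
  have hαeq : ∀ j, (0 - (-1)) * ⟪vorticityDirection (curl (u' j (-1))) (z j),
      fderiv ℝ (u' j (-1)) (z j) (vorticityDirection (curl (u' j (-1))) (z j))⟫ =
      (0 - t j) * ⟪vorticityDirection (curl (u j (t j))) (x j),
        fderiv ℝ (u j (t j)) (x j) (vorticityDirection (curl (u j (t j))) (x j))⟫ := fun j => by
    rw [hξ', hfd']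
    rw [show ((0 - t j) • fderiv ℝ (u j (t j)) (x j)) (vorticityDirection (curl (u j (t j))) (x j)) =
      (0 - t j) • fderiv ℝ (u j (t j)) (x j) (vorticityDirection (curl (u j (t j))) (x j)) from rfl,
      inner_smul_right]
    ring
  -- the rescaled points stay in a ball (near-records live in a parabolic cone, PART G)
  obtain ⟨R, hR, hcone⟩ := typeI_vorticity_nearRecord_cone hC₀ (w₀ / 2) (by positivity)
  have hzR : ∀ j, ‖z j‖ < R := fun j => by
    have hη : w₀ / 2 ≤ (0 - (-1)) * ‖curl (u' j (-1)) (z j)‖ := by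
      have h1 := hnear' j; have h2 := hδ1 j; have h3 := hW j
      norm_num; linarith
    have h := hcone (hcl j) (hIj j) (-1) (by norm_num) (z j) hη
    norm_num at h
    exact h
  obtain ⟨B, hB, hBb⟩ := typeI_vorticityNumber_bound hC₀
  have hWle : ∀ j, W j ≤ B + w₀ := fun j => by
    have h1 := hnear' j
    have h2 := hBb (hcl j) (hIj j) (-1) (by norm_num) (z j)
    have h3 : δ j ≤ w₀ := (hδ1 j).trans (by linarith)
    norm_num at h2
    linarith
  -- tangent field with gradients (PART H)
  obtain ⟨φ, hφ, v, hvc, hlimv, hdiff, hlimD, hcurlmv, hvI, hweak, -⟩ := typeI_tangent_field hC₀ hcl hIj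
  -- Bolzano–Weierstrass on the pairs (centre, number)
  have hmem : ∀ n, ((z (φ n), W (φ n)) : EuclideanSpace ℝ (Fin 3) × ℝ) ∈
      Metric.closedBall (0 : EuclideanSpace ℝ (Fin 3) × ℝ) (max R (B + w₀)) := fun n => by
    rw [mem_closedBall_zero_iff, Prod.norm_def]
    refine max_le_max (hzR _).le ?_
    rw [Real.norm_of_nonneg (by linarith [hW (φ n)])]
    exact hWle _
  obtain ⟨q, -, ψ, hψ, hq⟩ := tendsto_subseq_of_bounded (Metric.isBounded_closedBall) hmem
  have hψ' : Tendsto ψ atTop atTop := hψ.tendsto_atTop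
  have hzlim : Tendsto (fun j => z (φ (ψ j))) atTop (𝓝 q.1) := (continuous_fst.tendsto q).comp hq
  have hWlim : Tendsto (fun j => W (φ (ψ j))) atTop (𝓝 q.2) := (continuous_snd.tendsto q).comp hq
  obtain ⟨zbar, hzbar⟩ : ∃ zbar : EuclideanSpace ℝ (Fin 3), zbar = q.1 := ⟨_, rfl⟩
  obtain ⟨Wbar, hWbar⟩ : ∃ Wbar : ℝ, Wbar = q.2 := ⟨_, rfl⟩
  rw [← hzbar] at hzlim
  rw [← hWbar] at hWlim
  have hWbar0 : w₀ ≤ Wbar := ge_of_tendsto' hWlim fun j => hW _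
  -- uniform spatial Lipschitz bounds for vorticities and gradients at `t = -1` (PART H)
  obtain ⟨K₂, L₁, hK₂, hL₁, hG⟩ := exists_uniform_gradLipschitz hC₀
  have h14 : (-1 : ℝ) ≤ -(1 / 4 : ℝ) := by norm_num
  have hgl : ∀ j, LipschitzWith (Real.toNNReal (‖curlCLM‖ * K₂))
      (fun y => curl (u' (φ (ψ j)) (-1)) y) := fun j =>
    LipschitzWith.of_dist_le_mul fun a b => by
      rw [dist_eq_norm, dist_eq_norm, Real.coe_toNNReal _ (by positivity)]
      exact curl_sub_le_of_fderiv_lipschitz ((hG (hcl _) (hIj _)).1 (-1) h14) a b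
  have hgl' : ∀ j, LipschitzWith (Real.toNNReal K₂) (fun y => fderiv ℝ (u' (φ (ψ j)) (-1)) y) := fun j =>
    LipschitzWith.of_dist_le_mul fun a b => by
      rw [dist_eq_norm, dist_eq_norm, Real.coe_toNNReal _ hK₂]
      exact (hG (hcl _) (hIj _)).1 (-1) h14 a b
  -- moving-point convergence of vorticity and gradient at the rescaled points
  have hconvω : Tendsto (fun j => curl (u' (φ (ψ j)) (-1)) (z (φ (ψ j)))) atTop
      (𝓝 (curl (v (-1)) zbar)) :=
    ChaeWolf.tendsto_apply_of_tendsto hgl hzlim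
      ((hcurlmv (-1) h14 (fun _ => zbar) zbar tendsto_const_nhds).comp hψ')
  have hconvA : Tendsto (fun j => fderiv ℝ (u' (φ (ψ j)) (-1)) (z (φ (ψ j)))) atTop
      (𝓝 (fderiv ℝ (v (-1)) zbar)) :=
    ChaeWolf.tendsto_apply_of_tendsto hgl' hzlim ((hlimD (-1) h14 zbar).comp hψ')
  -- the limit point is an attained record of `v`: `‖ω_v(-1, zbar)‖ = Wbar`
  have hup : ∀ j, ‖curl (u' (φ (ψ j)) (-1)) (z (φ (ψ j)))‖ ≤ W (φ (ψ j)) := fun j => by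
    have h := hnum (φ (ψ j)) (-1) (by norm_num) (z (φ (ψ j)))
    norm_num at h
    exact h
  have hlow : Tendsto (fun j => W (φ (ψ j)) - δ (φ (ψ j))) atTop (𝓝 Wbar) := by
    have h0 : Tendsto (fun j => δ (φ (ψ j))) atTop (𝓝 0) := hδ.comp ((hφ.comp hψ).tendsto_atTop)
    simpa using hWlim.sub h0
  have hatt : ‖curl (v (-1)) zbar‖ = Wbar :=
    tendsto_nhds_unique hconvω.norm
      (tendsto_of_tendsto_of_tendsto_of_le_of_le hlow hWlim (fun j => hnear' _) hup)
  have hne : curl (v (-1)) zbar ≠ 0 := by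
    rw [← norm_pos_iff, hatt]; linarith
  -- `v` is dominated by `Wbar` on `s ≤ -1/4`
  have hnumv : ∀ s ≤ -(1 / 4 : ℝ), ∀ y, (0 - s) * ‖curl (v s) y‖ ≤ (0 - (-1)) * ‖curl (v (-1)) zbar‖ := by
    intro s hs y
    have hs0 : s < 0 := by linarith
    have hlim := ((hcurlmv s hs (fun _ => y) y tendsto_const_nhds).comp hψ').norm.const_mul (0 - s)
    have h := le_of_tendsto_of_tendsto' hlim hWlim fun j => hnum (φ (ψ j)) s hs0 y
    rw [hatt]; linarith
  have hP : IsTypeITangentPeak C₀ v zbar := ⟨hvc, hvI, hweak, hne, hnumv⟩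
  have hρ : 0 < ‖curl (v (-1)) zbar‖ := norm_pos_iff.mpr hne
  -- the stretching rates at the rescaled points converge to the stretching rate at the record
  have hconvξ : Tendsto (fun j => vorticityDirection (curl (u' (φ (ψ j)) (-1))) (z (φ (ψ j)))) atTop
      (𝓝 (vorticityDirection (curl (v (-1))) zbar)) := by
    simp only [vorticityDirection_apply]
    exact (hconvω.norm.inv₀ hρ.ne').smul hconvω
  have happly : Continuous fun w : ((EuclideanSpace ℝ (Fin 3)) →L[ℝ] (EuclideanSpace ℝ (Fin 3))) ×
      (EuclideanSpace ℝ (Fin 3)) => w.1 w.2 := isBoundedBilinearMap_apply.continuous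
  have hconvAξ : Tendsto (fun j => fderiv ℝ (u' (φ (ψ j)) (-1)) (z (φ (ψ j)))
      (vorticityDirection (curl (u' (φ (ψ j)) (-1))) (z (φ (ψ j))))) atTop
      (𝓝 (fderiv ℝ (v (-1)) zbar (vorticityDirection (curl (v (-1))) zbar))) :=
    (happly.tendsto (fderiv ℝ (v (-1)) zbar, vorticityDirection (curl (v (-1))) zbar)).comp
      (hconvA.prodMk_nhds hconvξ)
  have hconvα : Tendsto (fun j => (0 - (-1)) * ⟪vorticityDirection (curl (u' (φ (ψ j)) (-1))) (z (φ (ψ j))),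
      fderiv ℝ (u' (φ (ψ j)) (-1)) (z (φ (ψ j)))
        (vorticityDirection (curl (u' (φ (ψ j)) (-1))) (z (φ (ψ j))))⟫) atTop
      (𝓝 ((0 - (-1)) * ⟪vorticityDirection (curl (v (-1))) zbar,
        fderiv ℝ (v (-1)) zbar (vorticityDirection (curl (v (-1))) zbar)⟫)) :=
    (hconvξ.inner hconvAξ).const_mul _
  refine ⟨v, zbar, hP, hatt ▸ hWbar0, fun j => φ (ψ j), hφ.comp hψ, ?_⟩
  exact hconvα.congr fun j => hαeq (φ (ψ j))

end Summit.NavierStokesRegularity.NavierStokesRegularity.Theorems.StrainDoors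

end
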